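import Literature.NumberTheory.DiophantineGeometry.AbelianSchemeModelGeometricallyIrreducible
import Literature.AlgebraicGeometry.AbelianSchemes.AbelianSchemeGeneratesSpread
import Literature.AlgebraicGeometry.Motives.AbelianVarietyIsoOfScheme
import Literature.AlgebraicGeometry.Motives.GeneratesHomExtReduced
import HarnessLib

/-!
# Generation of the special fibre: if the generic fibre of `F : 𝒳 → 𝒜` generates `A`, its special fibre generates `𝒜_v`
# (Serre, *Morphismes universels*, no. 1–2; Lang, *Abelian Varieties*, II §3 — spread to the special fibre of an abelian-scheme model)

Topic `Literature/NumberTheory/DiophantineGeometry`, namespace `Literature.NumberTheory.DiophantineGeometry.IsAbelianSchemeModel`.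
THEOREMS ONLY (no definition, no named fact, no instance, no `sorry`).  Cell `hodgecm-mathlib` (D-0151), FLOOR 0, programme F0P5a
(D9op road 2′, crux item stmt-HodgeConjecture-24832): generic trunk assembly **G5/T4** of the L3a pole census
`F0/P5a/L3a-POLE-census.v0.1.F0P5a-p02g0.md` §5 — the «generation» input of the pointwise form C\* of `stub_L3a`.

Setting: `A/K` an abelian variety over a number field, `v` a finite place, `𝒜 → Spec 𝓞_{K,v}` an abelian-scheme model of `A` at `v`
(the tree's `IsAbelianSchemeModel A v 𝒜`), `𝒳 → Spec 𝓞_{K,v}` PROPER, and `F : 𝒳 ⟶ 𝒜` an `𝓞_{K,v}`-morphism (e.g. the Néron extension of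
the Albanese morphism `α′ : X × X → Alb_X` to the smooth proper model `𝒮 ×_R 𝒮` of the record curve).  Then:

* `generates_specialFibreFunctor_map` — **if the generic fibre `F_K : 𝒳_K → 𝒜_K ≅ A` GENERATES `A`** (some Serre sum map surjective,
  Lang II §3 / ★ `Motives.Generates`) **then the special fibre `F_v : 𝒳_v → 𝒜_v` generates the abelian variety `𝒜_v`**
  (★ `IsAbelianSchemeModel.specialFibre h`).  Proof: `𝒜` is a bundled abelian scheme over the discrete valuation ring `𝓞_{K,v}` (★ G4
  `geometricallyConnected_hom`), its fibre at `𝓞_{K,v} → K` is `A` (the model's `exists_iso`, read as an isomorphism of abelian varieties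
  by ★ `AbelianVariety.isoOfOverIso`), and generation spreads from the generic fibre to every fibre of an abelian scheme over a domain
  (★ `AbelianScheme.generates_fibre_of_generates_fibre_of_injective`, [Serre1958MorphismesUniversels] no. 2).
* `hom_ext_specialFibre_of_generates_genericFibre` — hence, when `𝒳_v` is smooth of some relative dimension over `κ(v)` (e.g. `𝒳`
  smooth over `𝓞_{K,v}`), two homomorphisms out of `𝒜_v` that agree after `F_v` are equal (★ `Generates.hom_ext_of_smoothOfRelativeDimension`).

HC_CM is proved only modulo the 7 printed citations until rung 0 closes; this file is a generic leaf and changes no count.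

## References
* [Serre1958MorphismesUniversels] J.-P. Serre, *Morphismes universels et variété d'Albanese*, Sém. Chevalley 4 (1958/59), exp. 10,
  no. 1 (Déf. 1), no. 2 (behaviour under extension/specialisation of the base).
* [Lang1983AbelianVarieties] S. Lang, *Abelian Varieties* (1959/1983), II §3 (p. 35).
* [SerreTate1968GoodReduction] J.-P. Serre, J. Tate, *Good reduction of abelian varieties*, Ann. of Math. 88 (1968), §1.
-/

set_option autoImplicit false

noncomputable section

open CategoryTheory CategoryTheory.Limits AlgebraicGeometry IsDedekindDomain IsDedekindDomain.HeightOneSpectrum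
open scoped MonObj NumberField CategoryTheory.Obj
open Literature.AlgebraicGeometry.Motives (AbelianVariety SchemeOver residueAt Generates pmSum pmSum_comp)
open Literature.AlgebraicGeometry.AbelianSchemes (AbelianScheme)
open Literature.NumberTheory.EllipticCurves (genericFibre specGenericPoint)

namespace Literature.NumberTheory.DiophantineGeometry

namespace IsAbelianSchemeModel

variable {K : Type} [Field K] [NumberField K] {v : HeightOneSpectrum (𝓞 K)} {A : AbelianVariety K}
  {𝒜 : SchemeOver (valuationSubringAtPrime K v)} [GrpObj 𝒜]

/-- Generation is invariant under isomorphisms of the target abelian variety: if `φ ≫ u` generates `C` for an isomorphism of abelian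
varieties `u : B ≅ C`, then `φ` generates `B` (the sum maps of `φ ≫ u` are those of `φ` followed by the isomorphism `u`, ★ `pmSum_comp`).
[cite: Lang1983AbelianVarieties, II §3 (p. 35)] -/
private theorem generates_of_generates_comp_iso {L : Type} [Field L] {X : SchemeOver L} {B C : AbelianVariety L}
    (φ : X ⟶ B.X) (u : B ≅ C) (h : Generates (A := C) (φ ≫ u.hom.hom.hom.hom)) : Generates (A := B) φ := by
  obtain ⟨n, hn⟩ := h
  refine ⟨n, ⟨?_⟩⟩
  rw [pmSum_comp φ u.hom n] at hn
  haveI := hn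
  have hs : Function.Surjective ⇑((pmSum φ n ≫ u.hom.hom.hom.hom) ≫ u.inv.hom.hom.hom).left := by
    rw [Over.comp_left, Scheme.Hom.comp_base, TopCat.coe_comp]
    have hinv : Function.Surjective ⇑(u.inv.hom.hom.hom).left := by
      have hii : u.hom ≫ u.inv = 𝟙 B := u.hom_inv_id
      intro b
      refine ⟨(u.hom.hom.hom.hom).left b, ?_⟩
      rw [← Scheme.Hom.comp_apply, ← Over.comp_left]
      change ((u.hom ≫ u.inv).hom.hom.hom).left b = b
      rw [hii]; rfl
    exact hinv.comp (pmSum φ n ≫ u.hom.hom.hom.hom).left.surjective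
  have hid : (pmSum φ n ≫ u.hom.hom.hom.hom) ≫ u.inv.hom.hom.hom = pmSum φ n := by
    rw [Category.assoc]
    change pmSum φ n ≫ (u.hom ≫ u.inv).hom.hom.hom = pmSum φ n
    rw [u.hom_inv_id]
    exact Category.comp_id _
  rwa [hid] at hs

/-- **Generation spreads to the special fibre of an abelian-scheme model.**  Let `h : IsAbelianSchemeModel A v 𝒜`, `𝒳 → Spec 𝓞_{K,v}`
proper, `F : 𝒳 ⟶ 𝒜`, and `e : 𝒜_K ≅ A` a group isomorphism of the generic fibre with `A`.  If `F_K ≫ e : 𝒳_K → A` generates `A`, then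
`F_v : 𝒳_v → 𝒜_v` generates the special fibre `𝒜_v = h.specialFibre`.  (Serre no. 2 / Lang II §3 through ★
`AbelianScheme.generates_fibre_of_generates_fibre_of_injective`, with `𝒜` bundled as an abelian scheme over the DVR `𝓞_{K,v}` by ★ G4
`geometricallyConnected_hom`.) [cite: Serre1958MorphismesUniversels, no. 2] [cite: Lang1983AbelianVarieties, II §3 (p. 35)]
[cite: SerreTate1968GoodReduction, §1] -/
theorem generates_specialFibreFunctor_map (h : IsAbelianSchemeModel A v 𝒜) {𝒳 : SchemeOver (valuationSubringAtPrime K v)}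
    [IsProper 𝒳.hom] (F : 𝒳 ⟶ 𝒜) (e : (genericFibre (valuationSubringAtPrime K v) K).obj 𝒜 ≅ A.X) [IsMonHom e.hom]
    (hgen : Generates (A := A) ((genericFibre (valuationSubringAtPrime K v) K).map F ≫ e.hom)) :
    Generates (A := h.specialFibre) ((specialFibreFunctor v).map F) := by
  -- `𝒜` as a bundled abelian scheme over the DVR
  let 𝒜b : AbelianScheme (valuationSubringAtPrime K v) :=
    { X := 𝒜
      isProper := h.isProper
      isSmooth := by haveI := h.smooth; exact SmoothOfRelativeDimension.smooth A.dim 𝒜.hom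
      geometricallyConnected := h.geometricallyConnected_hom }
  -- its fibre at `𝓞_{K,v} → K` is `A`
  have he : η[(𝒜b.fibre (algebraMap (valuationSubringAtPrime K v) K)).X] ≫ e.hom = η[A.X] := IsMonHom.one_hom e.hom
  let u : 𝒜b.fibre (algebraMap (valuationSubringAtPrime K v) K) ≅ A := AbelianVariety.isoOfOverIso e he
  have hgen' : Generates (A := 𝒜b.fibre (algebraMap (valuationSubringAtPrime K v) K))
      ((Over.pullback (AbelianScheme.specMap (algebraMap (valuationSubringAtPrime K v) K))).map F) :=
    generates_of_generates_comp_iso _ u hgen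
  have hinj : Function.Injective (algebraMap (valuationSubringAtPrime K v) K) :=
    FaithfulSMul.algebraMap_injective _ _
  exact AbelianScheme.generates_fibre_of_generates_fibre_of_injective (algebraMap (valuationSubringAtPrime K v) K) hinj
    𝒜b F hgen' (residueAt v)


/-- **Homomorphisms out of the special fibre are determined on `F_v`** when the generic fibre of `F` generates and the special fibre
`𝒳_v` of the (proper) source is smooth of some relative dimension over `κ(v)` (e.g. `𝒳` smooth over `𝓞_{K,v}`): two homomorphisms
`𝒜_v → B` agreeing after `F_v` are equal (`generates_specialFibreFunctor_map` + ★ `Generates.hom_ext_of_smoothOfRelativeDimension`).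
Use (F0P5a, C\* ⇒ `stub_L3a`): endomorphisms of the reduction `Ā_K` of `Alb(M⋆_K)` are compared on the difference points
`ᾱ′(x, y)` of the special fibre of the smooth model. [cite: Lang1983AbelianVarieties, II §3 (p. 35)] [cite: Serre1958MorphismesUniversels, no. 2] -/
theorem hom_ext_specialFibre_of_generates_genericFibre (h : IsAbelianSchemeModel A v 𝒜)
    {𝒳 : SchemeOver (valuationSubringAtPrime K v)} [IsProper 𝒳.hom] (F : 𝒳 ⟶ 𝒜)
    (e : (genericFibre (valuationSubringAtPrime K v) K).obj 𝒜 ≅ A.X) [IsMonHom e.hom]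
    (hgen : Generates (A := A) ((genericFibre (valuationSubringAtPrime K v) K).map F ≫ e.hom))
    {d : ℕ} [SmoothOfRelativeDimension d ((specialFibreFunctor v).obj 𝒳).hom]
    {B : AbelianVariety v.asIdeal.ResidueField} {u w : h.specialFibre ⟶ B}
    (huw : (specialFibreFunctor v).map F ≫ u.hom.hom.hom = (specialFibreFunctor v).map F ≫ w.hom.hom.hom) : u = w :=
  Literature.AlgebraicGeometry.Motives.Generates.hom_ext_of_smoothOfRelativeDimension (d := d)
    (h.generates_specialFibreFunctor_map F e hgen) huw

end IsAbelianSchemeModel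

end Literature.NumberTheory.DiophantineGeometry

end
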